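import Summits.Ventures.PercRepro.Night2ThreeTwoBasisMass
import Summits.Ventures.PercRepro.Night2ThreeTwoMissedSmall

/-!
# PercRepro — the cell `(3, 2)` for `|V| ≥ 11`: the targets with three points off the common line are GOOD
(night-2, gen 25)

In the obstruction cell with `|V| ≥ 11` every hyperplane missing `≤ 3` points contains the common line `ℓ`
(`exists_common_line`).  A target `S` with at least three points off `ℓ` has at most ONE thin covering preimage missing
`≤ 3` points (two would force a third off-line point into the rank-`2` intersection of their hyperplanes, which is `ℓ`),
so its layer-1 request is `≤ 7/30 + Φ/7 = 2/5 < 5/12 ≤ capS`: it is unsaturated with `cap2 ≥ 1/60`, and after the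
missed-point loads of the big pairs it keeps `cap3 ≥ 1/60` (`cap2 ≥ 11/60` at a target with sources, `dload ≤ 3/20`).
These are the «good targets» of the basis pairs' count (proofs/NIGHT-2-g25.md §5‴).

* `line_closed_in_V`: the common line `(cl B₁ ∩ cl B₂) ∖ K` is closed inside `V`;
* `card_big_coverPreimages_le_one_of_three_off`: at most one big thin covering preimage;
* `L1_le_two_fifths_of_three_off`, **`cap2_ge_of_three_off`** (`≥ 1/60`);
* `card_three_sources_le_four_of_eleven`, `dload_missed_le_of_eleven` (`≤ 3/20`), **`cap3_ge_of_three_off`** (`≥ 1/60`).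
-/

namespace PercRepro.Shadow

open Finset PerFlat ThmH

variable {α : Type*} [DecidableEq α] {M : Matroid α} [M.Finite]

section GoodTargets

variable {G : Finset α}

/-- The common line `(cl B₁ ∩ cl B₂) ∖ K` is closed inside `V = G ∖ K`. -/
theorem line_closed_in_V {B₁ B₂ : Finset α} {x : α} (hx : x ∈ G \ coloops M G)
    (hcl : x ∈ clF M ((clF M B₁ ∩ clF M B₂) \ coloops M G)) : x ∈ (clF M B₁ ∩ clF M B₂) \ coloops M G := by
  have key : ∀ B : Finset α, (clF M B₁ ∩ clF M B₂) \ coloops M G ⊆ clF M B →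
      x ∈ clF M B := by
    intro B hB
    have h := M.closure_subset_closure (X := (((clF M B₁ ∩ clF M B₂) \ coloops M G : Finset α) : Set α))
      (Y := ((clF M B : Finset α) : Set α)) (by exact_mod_cast hB)
    rw [coe_clF M B, M.closure_closure] at h
    rw [← Finset.mem_coe, coe_clF] at hcl ⊢
    exact h hcl
  refine Finset.mem_sdiff.2 ⟨Finset.mem_inter.2 ⟨?_, ?_⟩, (Finset.mem_sdiff.1 hx).2⟩
  · exact key B₁ (fun a ha => (Finset.mem_inter.1 (Finset.mem_sdiff.1 ha).1).1)
  · exact key B₂ (fun a ha => (Finset.mem_inter.1 (Finset.mem_sdiff.1 ha).1).2)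

open scoped Classical in
/-- **At most one big thin covering preimage at a target with three points off the line** (`|V| ≥ 11`). -/
theorem card_big_coverPreimages_le_one_of_three_off (hG : G ∈ flatsQ M (5 + 1)) (hd : (gr M \ G).card ≤ 5)
    (hk : kColoops M G = 2) (hs : ∀ e ∈ gr M, ∀ f ∈ gr M, e ≠ f → rkN M {e, f} = 2)
    {ℓ : Finset α} (hℓr : rkN M ℓ ≤ 2) (hℓ2 : 2 ≤ ℓ.card) (hℓV : ℓ ⊆ G \ coloops M G)
    (hℓcl : ∀ x ∈ G \ coloops M G, x ∈ clF M ℓ → x ∈ ℓ)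
    (hℓ : ∀ B ∈ thinMembers M 5 G, (G \ clF M B).card ≤ 3 → ℓ ⊆ clF M B)
    {S : Finset α} (hS : S ∈ shadowAt M (5 + 2) 5 (Uq M (5 + 2) 5) G) (h3 : 3 ≤ ((S \ coloops M G) \ ℓ).card) :
    ((coverPreimages M (Uq M (5 + 2) 5) G S).filter
      (fun B => B ∉ lay0 M 5 G ∧ (G \ clF M B).card ≤ 3)).card ≤ 1 := by
  have hGg : G ⊆ gr M := (mem_flatsQ.1 hG).1
  rw [Finset.card_le_one]
  intro B₁ h₁ B₂ h₂
  rw [Finset.mem_filter] at h₁ h₂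
  have hthin₁ : B₁ ∈ thinMembers M 5 G := mem_thinMembers.2 ⟨(mem_coverPreimages.1 h₁.1).1, h₁.2.1⟩
  have hthin₂ : B₂ ∈ thinMembers M 5 G := mem_thinMembers.2 ⟨(mem_coverPreimages.1 h₂.1).1, h₂.2.1⟩
  by_contra hne
  have hHne : clF M B₁ ≠ clF M B₂ := fun h => hne (clF_injOn_coverPreimages h₁.1 h₂.1 h)
  obtain ⟨w₁, -, -, hB₁⟩ := coverPreimage_eq_erase h₁.1
  obtain ⟨w₂, -, -, hB₂⟩ := coverPreimage_eq_erase h₂.1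
  -- a third off-line point of `S` lies in both hyperplanes
  obtain ⟨x, hx⟩ : (((S \ coloops M G) \ ℓ) \ {w₁, w₂}).Nonempty := by
    rw [← Finset.card_pos]
    have := Finset.le_card_sdiff ({w₁, w₂} : Finset α) ((S \ coloops M G) \ ℓ)
    have hc : ({w₁, w₂} : Finset α).card ≤ 2 := Finset.card_le_two
    omega
  rw [Finset.mem_sdiff, Finset.mem_sdiff, Finset.mem_sdiff, Finset.mem_insert, Finset.mem_singleton, not_or] at hx
  obtain ⟨⟨⟨hxS, hxK⟩, hxℓ⟩, hxw₁, hxw₂⟩ := hx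
  have hxB₁ : x ∈ B₁ := by rw [hB₁, Finset.mem_erase]; exact ⟨hxw₁, hxS⟩
  have hxB₂ : x ∈ B₂ := by rw [hB₂, Finset.mem_erase]; exact ⟨hxw₂, hxS⟩
  have hBU₁ : B₁ ∈ Uq M (5 + 2) 5 := (mem_membersIn.1 (mem_thinMembers.1 hthin₁).1).1
  have hBU₂ : B₂ ∈ Uq M (5 + 2) 5 := (mem_membersIn.1 (mem_thinMembers.1 hthin₂).1).1
  set R := (clF M B₁ ∩ clF M B₂) \ coloops M G with hR
  have hxR : x ∈ R :=
    Finset.mem_sdiff.2 ⟨Finset.mem_inter.2 ⟨subset_clF hBU₁ hxB₁, subset_clF hBU₂ hxB₂⟩, hxK⟩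
  have hℓR : ℓ ⊆ R := by
    intro a ha
    exact Finset.mem_sdiff.2 ⟨Finset.mem_inter.2 ⟨hℓ B₁ hthin₁ h₁.2.2 ha, hℓ B₂ hthin₂ h₂.2.2 ha⟩,
      (Finset.mem_sdiff.1 (hℓV ha)).2⟩
  have hRr : rkN M R ≤ 2 := rkN_inter_clF_sdiff_coloops_le_two hG hd hk hthin₁ hthin₂ hHne
  have hRg : R ⊆ gr M := fun a ha =>
    hGg ((mem_membersIn.1 (mem_thinMembers.1 hthin₁).1).2 (Finset.mem_inter.1 (Finset.mem_sdiff.1 ha).1).1)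
  -- `R ⊆ cl ℓ`: equal ranks
  have hℓ2' : 2 ≤ rkN M ℓ := two_le_rkN_of_two_le_card hs (hℓV.trans (fun a ha => hGg (Finset.mem_sdiff.1 ha).1)) hℓ2
  have heq : rkN M ℓ = rkN M R := by
    have := rkN_mono (M := M) hℓR
    omega
  have hRcl := subset_closure_of_rkN_eq hRg hℓR heq
  rw [← coe_clF, Finset.coe_subset] at hRcl
  exact hxℓ (hℓcl x (Finset.mem_sdiff.2 ⟨subset_G_of_mem_shadowAt hS hxS, hxK⟩) (hRcl hxR))

open scoped Classical in
/-- **A target with three points off the line is unsaturated with `cap2 ≥ 1/60`** (`|V| ≥ 11`): one request `≤ 7/30`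
and one `≤ Φ/7 = 1/6`. -/
theorem cap2_ge_of_three_off (hG : G ∈ flatsQ M (5 + 1)) (hd : (gr M \ G).card = 3) (hk : kColoops M G = 2)
    (hs : ∀ e ∈ gr M, ∀ f ∈ gr M, e ≠ f → rkN M {e, f} = 2) (hl : ∀ e ∈ gr M, M.Indep {e})
    {ℓ : Finset α} (hℓr : rkN M ℓ ≤ 2) (hℓ2 : 2 ≤ ℓ.card) (hℓV : ℓ ⊆ G \ coloops M G)
    (hℓcl : ∀ x ∈ G \ coloops M G, x ∈ clF M ℓ → x ∈ ℓ)
    (hℓ : ∀ B ∈ thinMembers M 5 G, (G \ clF M B).card ≤ 3 → ℓ ⊆ clF M B)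
    {S : Finset α} (hS : S ∈ shadowAt M (5 + 2) 5 (Uq M (5 + 2) 5) G) (h3 : 3 ≤ ((S \ coloops M G) \ ℓ).card)
    (hcard : 4 + 1 ≤ (S \ coloops M G).card) :
    L1 M 5 G S ≤ capS M 5 G S ∧ (1 / 60 : ℚ) ≤ cap2 M 5 G S := by
  have hd' : (gr M \ G).card ≤ 5 := by omega
  have hk' : kColoops M G + 4 = 5 + 1 := by omega
  set P := (coverPreimages M (Uq M (5 + 2) 5) G S).filter (fun B => B ∉ lay0 M 5 G) with hP
  have hL1 : L1 M 5 G S = ∑ B ∈ P, req M 5 B := rfl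
  have hPcard : P.card + 2 ≤ 4 := card_thin_coverPreimages_add_two_le hG hd' hk' hs hl hS hcard
  have hthin : ∀ B ∈ P, B ∈ thinMembers M 5 G := by
    intro B hB
    rw [hP, Finset.mem_filter, mem_coverPreimages] at hB
    exact mem_thinMembers.2 ⟨hB.1.1, hB.2⟩
  have hbig := card_big_coverPreimages_le_one_of_three_off hG hd' hk hs hℓr hℓ2 hℓV hℓcl hℓ hS h3
  -- split `P` into the big preimages (`≤ 1`, request `≤ 7/30`) and the others (request `≤ 1/6`)
  have hreq_small : ∀ B ∈ P, ¬ (G \ clF M B).card ≤ 3 → req M 5 B ≤ 1 / 6 := by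
    intro B hB hm
    push Not at hm
    rw [req_eq_of_thin hG (hthin B hB), hd]
    have h4 : (4 : ℚ) ≤ ((G \ clF M B).card : ℚ) := by exact_mod_cast hm
    unfold phiQ
    push_cast
    rw [div_le_iff₀ (by linarith)]
    linarith
  have hsplit : P = P.filter (fun B => (G \ clF M B).card ≤ 3) ∪ P.filter (fun B => ¬ (G \ clF M B).card ≤ 3) :=
    (Finset.filter_union_filter_not_eq _ _).symm
  have hPeq : P.filter (fun B => (G \ clF M B).card ≤ 3) =
      (coverPreimages M (Uq M (5 + 2) 5) G S).filter (fun B => B ∉ lay0 M 5 G ∧ (G \ clF M B).card ≤ 3) := by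
    rw [hP, Finset.filter_filter]
  have he1 : (P.filter (fun B => (G \ clF M B).card ≤ 3)).card ≤ 1 := by rw [hPeq]; exact hbig
  have hef : (P.filter (fun B => (G \ clF M B).card ≤ 3)).card +
      (P.filter (fun B => ¬ (G \ clF M B).card ≤ 3)).card ≤ 2 := by
    have hsum := Finset.card_union_of_disjoint (Finset.disjoint_filter_filter_not P P
      (fun B => (G \ clF M B).card ≤ 3))
    rw [← hsplit] at hsum
    omega
  have hL1le : L1 M 5 G S ≤ 2 / 5 := by
    rw [hL1, hsplit, Finset.sum_union (Finset.disjoint_filter_filter_not _ _ _)]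
    have hA : ∑ B ∈ P.filter (fun B => (G \ clF M B).card ≤ 3), req M 5 B ≤
        ((P.filter (fun B => (G \ clF M B).card ≤ 3)).card : ℚ) * (7 / 30) := by
      calc ∑ B ∈ P.filter (fun B => (G \ clF M B).card ≤ 3), req M 5 B
          ≤ ∑ _B ∈ P.filter (fun B => (G \ clF M B).card ≤ 3), (7 / 30 : ℚ) :=
            Finset.sum_le_sum (fun B hB => req_le_of_thin_three_two hG hd (hthin B (Finset.mem_filter.1 hB).1))
        _ = _ := by rw [Finset.sum_const, nsmul_eq_mul]
    have hB : ∑ B ∈ P.filter (fun B => ¬ (G \ clF M B).card ≤ 3), req M 5 B ≤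
        ((P.filter (fun B => ¬ (G \ clF M B).card ≤ 3)).card : ℚ) * (1 / 6) := by
      calc ∑ B ∈ P.filter (fun B => ¬ (G \ clF M B).card ≤ 3), req M 5 B
          ≤ ∑ _B ∈ P.filter (fun B => ¬ (G \ clF M B).card ≤ 3), (1 / 6 : ℚ) :=
            Finset.sum_le_sum (fun B hB => hreq_small B (Finset.mem_filter.1 hB).1 (Finset.mem_filter.1 hB).2)
        _ = _ := by rw [Finset.sum_const, nsmul_eq_mul]
    have he1' : ((P.filter (fun B => (G \ clF M B).card ≤ 3)).card : ℚ) ≤ 1 := by exact_mod_cast he1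
    have hef' : ((P.filter (fun B => (G \ clF M B).card ≤ 3)).card : ℚ) +
        ((P.filter (fun B => ¬ (G \ clF M B).card ≤ 3)).card : ℚ) ≤ 2 := by
      have h := (Nat.cast_le (α := ℚ)).2 hef
      rw [Nat.cast_add] at h
      exact h.trans (by norm_num)
    have he0 : (0 : ℚ) ≤ ((P.filter (fun B => (G \ clF M B).card ≤ 3)).card : ℚ) := Nat.cast_nonneg _
    linarith
  have hcap := capS_ge_five_twelfths_three_two hd hk (subset_G_of_mem_shadowAt hS)
  refine ⟨by linarith, ?_⟩
  unfold cap2 fS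
  rw [if_pos (by linarith)]
  linarith

open scoped Classical in
/-- At most four sources missing exactly three points at any target (`|V| ≥ 11`). -/
theorem card_three_sources_le_four_of_eleven (hG : G ∈ flatsQ M (5 + 1)) (hd : (gr M \ G).card ≤ 5)
    (hk : kColoops M G = 2) (hs : ∀ e ∈ gr M, ∀ f ∈ gr M, e ≠ f → rkN M {e, f} = 2)
    (h11 : 11 ≤ (G \ coloops M G).card) {P : Finset α → Prop} [DecidablePred P] (S : Finset α) :
    ((missedSources M 5 G P S).filter (fun B => (G \ clF M B).card = 3)).card ≤ 4 := by
  rw [card_sources_le_card_image_clF]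
  apply card_le_four_of_inter_subset (S := G)
  · intro H hH
    obtain ⟨B', hB', rfl⟩ := Finset.mem_image.1 hH
    exact (mem_membersIn.1 (mem_thinMembers.1 (mem_missedSources.1 (Finset.mem_filter.1 hB').1).1.1).1).2
  · intro H hH
    obtain ⟨B', hB', rfl⟩ := Finset.mem_image.1 hH
    exact (Finset.mem_filter.1 hB').2
  · intro H hH H' hH' H'' hH'' hne
    obtain ⟨B₁, hB₁, rfl⟩ := Finset.mem_image.1 hH
    obtain ⟨B₂, hB₂, rfl⟩ := Finset.mem_image.1 hH'
    obtain ⟨B₃, hB₃, rfl⟩ := Finset.mem_image.1 hH''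
    exact inter_clF_subset_of_three_eleven hG hd hk hs h11
      (mem_missedSources.1 (Finset.mem_filter.1 hB₁).1).1.1
      (mem_missedSources.1 (Finset.mem_filter.1 hB₂).1).1.1
      (mem_missedSources.1 (Finset.mem_filter.1 hB₃).1).1.1
      (by rw [(Finset.mem_filter.1 hB₁).2]) (by rw [(Finset.mem_filter.1 hB₂).2])
      (by rw [(Finset.mem_filter.1 hB₃).2]) hne

open scoped Classical in
/-- The distance-one load of any target is at most `3/20` (`|V| ≥ 11`, `P ⊆` the big members): with two fat sources no
source misses three points (`no_three_source_of_two_fat`), so the load is `≤ 3/20` or `≤ 1/20 + 4/198`. -/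
theorem dload_missed_le_of_eleven (hG : G ∈ flatsQ M (5 + 1)) (hd : (gr M \ G).card = 3) (hk : kColoops M G = 2)
    (hs : ∀ e ∈ gr M, ∀ f ∈ gr M, e ≠ f → rkN M {e, f} = 2) (hl : ∀ e ∈ gr M, M.Indep {e})
    (h11 : 11 ≤ (G \ coloops M G).card) {P : Finset α → Prop} [DecidablePred P]
    (hP : ∀ B, P B → 4 ≤ (B \ coloops M G).card) (S : Finset α) :
    dload M 5 G P (dshMissed M 5 G) S ≤ 3 / 20 := by
  have hd' : (gr M \ G).card ≤ 5 := by omega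
  have hw := dload_missed_le_weighted hG hd hk hs hl hP S
  have hF := card_fat_sources_le_three hG hd' hk hs (by omega) (P := P) S
  have hR := card_three_sources_le_four_of_eleven hG hd' hk hs h11 (P := P) S
  set F := (missedSources M 5 G P S).filter (fun B => (G \ clF M B).card = 2) with hF_def
  set R := (missedSources M 5 G P S).filter (fun B => (G \ clF M B).card = 3) with hR_def
  have hF' : (F.card : ℚ) ≤ 3 := by exact_mod_cast hF
  have hR' : (R.card : ℚ) ≤ 4 := by exact_mod_cast hR
  rcases Nat.lt_or_ge F.card 2 with hF1 | hF2
  · have hF1' : (F.card : ℚ) ≤ 1 := by exact_mod_cast (by omega : F.card ≤ 1)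
    linarith
  · obtain ⟨B₁, hB₁, B₂, hB₂, hne12⟩ := Finset.one_lt_card.1 hF2
    rw [hF_def, Finset.mem_filter] at hB₁ hB₂
    have hR0 : R.card = 0 := by
      apply no_three_source_of_two_fat hG hd' hk hs hB₁.1 hB₂.1 hB₁.2 hB₂.2 hne12
      have := Finset.card_union_le (G \ clF M B₁) (G \ clF M B₂)
      omega
    rw [hR0] at hw
    push_cast at hw
    linarith

open scoped Classical in
/-- **A target with three points off the line keeps `cap3 ≥ 1/60`** (`|V| ≥ 11`): `cap2 ≥ 1/60` without sources,
`cap2 ≥ 11/60` with a source against `dload ≤ 3/20`. -/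
theorem cap3_ge_of_three_off (hG : G ∈ flatsQ M (5 + 1)) (hd : (gr M \ G).card = 3) (hk : kColoops M G = 2)
    (hs : ∀ e ∈ gr M, ∀ f ∈ gr M, e ≠ f → rkN M {e, f} = 2) (hl : ∀ e ∈ gr M, M.Indep {e})
    (h11 : 11 ≤ (G \ coloops M G).card) {P : Finset α → Prop} [DecidablePred P]
    (hP : ∀ B, P B → 4 ≤ (B \ coloops M G).card)
    {ℓ : Finset α} (hℓr : rkN M ℓ ≤ 2) (hℓ2 : 2 ≤ ℓ.card) (hℓV : ℓ ⊆ G \ coloops M G)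
    (hℓcl : ∀ x ∈ G \ coloops M G, x ∈ clF M ℓ → x ∈ ℓ)
    (hℓ : ∀ B ∈ thinMembers M 5 G, (G \ clF M B).card ≤ 3 → ℓ ⊆ clF M B)
    {S : Finset α} (hS : S ∈ shadowAt M (5 + 2) 5 (Uq M (5 + 2) 5) G) (h3 : 3 ≤ ((S \ coloops M G) \ ℓ).card)
    (hcard : 4 + 1 ≤ (S \ coloops M G).card) :
    (1 / 60 : ℚ) ≤ cap3 M 5 G P (dshMissed M 5 G) S := by
  have hd' : (gr M \ G).card ≤ 5 := by omega
  unfold cap3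
  by_cases hne : (missedSources M 5 G P S).Nonempty
  · obtain ⟨B, hB⟩ := hne
    obtain ⟨⟨hthin, hPB⟩, hBS, hc2, hsub⟩ := mem_missedSources.1 hB
    obtain ⟨z, x, hzx, hzx'⟩ := Finset.card_eq_two.1 hc2
    have hz : z ∈ G \ clF M B := hsub (by rw [hzx']; exact Finset.mem_insert_self _ _)
    have hx : x ∈ G \ clF M B := hsub (by rw [hzx']; exact Finset.mem_insert_of_mem (Finset.mem_singleton_self _))
    have hSeq : S = insert x (insert z B) := by
      ext a
      constructor
      · intro ha
        by_cases haB : a ∈ B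
        · exact Finset.mem_insert_of_mem (Finset.mem_insert_of_mem haB)
        · have : a ∈ S \ B := Finset.mem_sdiff.2 ⟨ha, haB⟩
          rw [hzx', Finset.mem_insert, Finset.mem_singleton] at this
          rcases this with rfl | rfl
          · exact Finset.mem_insert_of_mem (Finset.mem_insert_self _ _)
          · exact Finset.mem_insert_self _ _
      · intro ha
        rw [Finset.mem_insert, Finset.mem_insert] at ha
        rcases ha with rfl | rfl | haB
        · exact (Finset.mem_sdiff.1 (by rw [hzx']; exact Finset.mem_insert_of_mem (Finset.mem_singleton_self _) :
            a ∈ S \ B)).1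
        · exact (Finset.mem_sdiff.1 (by rw [hzx']; exact Finset.mem_insert_self _ _ : a ∈ S \ B)).1
        · exact hBS haB
    have hcap : (11 / 60 : ℚ) ≤ cap2 M 5 G S := by
      rw [hSeq]
      exact cap2_ge_of_missed_three_two hG hd hk hs hthin (hP B hPB) hz hx hzx
    have := dload_missed_le_of_eleven hG hd hk hs hl h11 hP S
    linarith
  · rw [Finset.not_nonempty_iff_eq_empty] at hne
    have hw := dload_missed_le_card_sources_three_two hG hd hk hs hl hP S
    rw [hne, Finset.card_empty] at hw
    have h0 := dload_nonneg (M := M) (q := 5) (G := G) (P := P) (dshMissed_nonneg hG hd') S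
    have := (cap2_ge_of_three_off hG hd hk hs hl hℓr hℓ2 hℓV hℓcl hℓ hS h3 hcard).2
    push_cast at hw
    linarith

end GoodTargets

end PercRepro.Shadow
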